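import Summits.QuantumFields.YangMills.Theorems.ColdStartUniversalityLatticeLangevinLinkGradDictionary
import Summits.QuantumFields.YangMills.Theorems.ColdStartUniversalityLatticeLangevinFunctionalInequalitiesOfEnergy
import HarnessLib

/-!
# Route `ColdStartUniversality` (fixed-cut-off package): SHEN–ZHU–ZHU'S THEOREM 1.4 FOR `SU(2)`, `d = 3` IN THE PRINTED GRADIENT FORM —
# `Ent_μ(F²) ≤ (2/K) Σ_e μ(|∇_e F|²)` and `Var_μ(F) ≤ (1/K) Σ_e μ(|∇_e F|²)` for every infinite-volume limit point, `K = 1 − 24|β|`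

Helper file (seat `ym-line-csu-p1`, g38; `--supports stmt-QuantumFields-24809`).  The tree's named fact `shenZhuZhu_functionalInequalities` (discharged
for `(3,2)` in `…ShenZhuZhuFunctionalInequalitiesSU2`) renders Shen–Zhu–Zhu's (1.9)–(1.10) in LIPSCHITZ form (`Σ_e L_e²` on the right).  This file
proves the PRINTED form with the squared link gradients `μ(|∇_e F|²)` — the Literature's `linkGradSq Λ f e` (`LatticeYangMillsUniformLogSobolev`,
the currency of the kernel log-Sobolev fact `bakryEmery_kernelLogSobolev`) — which is stronger (`|∇_e F|² ≤ L_e²`) and is the form Herbst-type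
concentration arguments use:
* `linkGradSq_eq_sum_sq_fderiv`, `continuous_linkGradSq` — `linkGradSq Λ f e M = Σ_α (Df(M)[single_e(Y_α M_e)])²` (chain rule), hence continuity in `M`;
* ★★ `torus_variance_le_sum_linkGradSq_of_hessBound`, `torus_entropy_le_sum_linkGradSq_of_hessBound` — on every torus `(ℤ/L)³` onto which `Λ`
  projects injectively, under a frame-Hessian bound `K₀ < 2`: `Var_(μ_L)(F∘torusLift) ≤ K⁻¹ Σ_(e∈Λ) ∫ |∇_e F|² dμ_L` and
  `Ent_(μ_L)((F∘torusLift)²) ≤ 2K⁻¹ Σ_(e∈Λ) ∫ |∇_e F|² dμ_L`, `K = 1 − K₀/2` (Shen–Zhu–Zhu's Cor. 4.4 (4.11) verbatim; `…FunctionalInequalitiesOfEnergy` +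
  the dictionary `carre_eq_two_mul_sum_linkGradSq`);
* ★★★ `szzGradientForm_su2_of_hessBound` — for every infinite-volume limit point `μ` at tree coupling `2β` (weak limit along tori of BOTH sides);
* ★★★ `szzGradientForm_su2_sharp` — `|β| < 1/24`: `Ent_μ(F²) ≤ (2/(1 − 24|β|)) Σ_e ∫|∇_e F|² dμ`, `Var_μ(F) ≤ (1/(1 − 24|β|)) Σ_e ∫|∇_e F|² dμ` for every
  limit point and every smooth cylinder function — Shen–Zhu–Zhu (1.9)–(1.10) for `SU(2)`, `d = 3`, sharp constant (printed: `K_S = 1 − 32|β|`,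
  `|β| < 1/32`: `szzGradientForm_su2_printed`).
THEOREMS ONLY, no definition, no sorry.  HONEST FRAMING: STRONG-coupling, fixed-lattice statements; nothing at weak coupling / in the continuum,
nothing `K`-uniform along the route's scaling (`UniformColdStartMixing`, 24809, ASIDE, not restated); no crux, rung or summit statement is proved;
the Yang–Mills mass gap is NOT proved.
-/

set_option autoImplicit false

noncomputable section

namespace Summit.QuantumFields.YangMills.Theorems.ColdStartUniversality

open MeasureTheory ProbabilityTheory Finset Filter Set Metric
open scoped BigOperators NNReal ENNReal Topology Matrix.Norms.Frobenius ContDiff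
open Literature.Probability.Process Literature.MathematicalPhysics.QuantumFieldTheory
open Literature.MathematicalPhysics.QuantumLattice (fundamentalRep fundamentalLatticeRep continuous_fundamentalRep fundamentalRep_apply
  torusEdge torusLift toTorusObservable toTorusObservable_apply infiniteVolumeLimitPoints IsInfiniteVolumeLimitAlong IsCylinder LGConfig)

/-! ## §1. `linkGradSq` in closed form; continuity -/

/-- **`linkGradSq` through the differential**: for a differentiable `f` of the link matrices over `Λ`, a link `e ∈ Λ` and matrices `M`,
`linkGradSq Λ f e M = Σ_α (Df(M)[single_e(Y_α M_e)])²` (chain rule along `t ↦ M with M_e ↦ e^(tY_α)M_e`). [cite: ShenZhuZhuCMP2023, (1.8)] -/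
theorem linkGradSq_eq_sum_sq_fderiv {d N : ℕ} (Λ : Finset (Literature.MathematicalPhysics.QuantumLattice.ZdEdge d))
    {f : (↥Λ → Matrix (Fin N) (Fin N) ℂ) → ℝ} (hf : Differentiable ℝ f) (e : ↥Λ) (M : ↥Λ → Matrix (Fin N) (Fin N) ℂ) :
    linkGradSq Λ f e M = ∑ α : SUNBakryEmery.FrameIdx N, (fderiv ℝ f M (Pi.single e (SUNBakryEmery.frame α * M e))) ^ 2 := by
  classical
  unfold linkGradSq
  refine Finset.sum_congr rfl fun α _ => ?_
  congr 1
  set Y : Matrix (Fin N) (Fin N) ℂ := SUNBakryEmery.frame α with hY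
  -- the curve `c(t) = e^(tY) M_e` and the affine map `X ↦ update M e X`
  have hc : HasDerivAt (fun t : ℝ => NormedSpace.exp (t • Y) * M e) (Y * NormedSpace.exp ((0 : ℝ) • Y) * M e) 0 :=
    (hasDerivAt_exp_smul_const' (𝕂 := ℝ) Y (0 : ℝ)).mul_const (M e)
  have hc' : HasDerivAt (fun t : ℝ => NormedSpace.exp (t • Y) * M e) (Y * M e) 0 := by
    have h := hc
    rwa [zero_smul, NormedSpace.exp_zero, mul_one] at h
  have hc0 : NormedSpace.exp ((0 : ℝ) • Y) * M e = M e := by rw [zero_smul, NormedSpace.exp_zero, one_mul]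
  have huc : HasDerivAt (fun t : ℝ => Function.update M e (NormedSpace.exp (t • Y) * M e))
      (Pi.single e (Y * M e) : ↥Λ → Matrix (Fin N) (Fin N) ℂ) 0 := by
    have h := (hasFDerivAt_update M (i := e) (NormedSpace.exp ((0 : ℝ) • Y) * M e)).comp_hasDerivAt (0 : ℝ) hc'
    refine h.congr_deriv ?_
    funext i
    rw [ContinuousLinearMap.pi_apply]
    by_cases hi : i = e
    · subst hi; simp
    · simp [hi]
  have hbase : Function.update M e (NormedSpace.exp ((0 : ℝ) • Y) * M e) = M := by
    rw [hc0, Function.update_eq_self]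
  have hf' : HasFDerivAt f (fderiv ℝ f M) (Function.update M e (NormedSpace.exp ((0 : ℝ) • Y) * M e)) := by
    rw [hbase]; exact (hf M).hasFDerivAt
  have hcomp := hf'.comp_hasDerivAt (0 : ℝ) huc
  exact hcomp.deriv

/-- **Continuity of `M ↦ linkGradSq Λ f e M`** for smooth `f`. [folklore] -/
theorem continuous_linkGradSq {d N : ℕ} (Λ : Finset (Literature.MathematicalPhysics.QuantumLattice.ZdEdge d))
    {f : (↥Λ → Matrix (Fin N) (Fin N) ℂ) → ℝ} (hf : ContDiff ℝ ∞ f) (e : ↥Λ) :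
    Continuous fun M : ↥Λ → Matrix (Fin N) (Fin N) ℂ => linkGradSq Λ f e M := by
  classical
  have hfd : Differentiable ℝ f := hf.differentiable (by simp)
  have hfun : (fun M : ↥Λ → Matrix (Fin N) (Fin N) ℂ => linkGradSq Λ f e M) =
      fun M => ∑ α : SUNBakryEmery.FrameIdx N, (fderiv ℝ f M (Pi.single e (SUNBakryEmery.frame α * M e))) ^ 2 := by
    funext M; exact linkGradSq_eq_sum_sq_fderiv Λ hfd e M
  rw [hfun]
  refine continuous_finsetSum _ fun α _ => ?_
  refine Continuous.pow ?_ 2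
  have h1 : Continuous (fderiv ℝ f) := hf.continuous_fderiv (by simp)
  have h2 : Continuous fun M : ↥Λ → Matrix (Fin N) (Fin N) ℂ => (Pi.single e (SUNBakryEmery.frame α * M e) : ↥Λ → Matrix (Fin N) (Fin N) ℂ) := by
    refine continuous_pi fun i => ?_
    by_cases h : i = e
    · subst h
      simp only [Pi.single_eq_same]
      exact continuous_const.mul (continuous_apply i)
    · simp only [Pi.single_eq_of_ne h]
      exact continuous_const
  exact h1.clm_apply h2

/-! ## §2. Shen–Zhu–Zhu's (4.11) on every torus in gradient form -/

section Torus

variable {L : ℕ} [NeZero L]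

/-- ★★ **Variance on the torus, gradient form** (Shen–Zhu–Zhu Cor. 4.4 (4.11), Poincaré half, verbatim for `SU(2)`, `d = 3`): under a frame-Hessian
bound `K₀ < 2`, for every finite `Λ ⊆ E⁺(ℤ³)` projecting injectively to `(ℤ/L)³` and every smooth `f` of the link matrices over `Λ`:
`∫ (F∘lift − ∫F∘lift)² dμ_(β') ≤ (1 − K₀/2)⁻¹ Σ_(e∈Λ) ∫ |∇_e F|² dμ_(β')`, `F = f((U_e)_(e∈Λ))`, `lift = torusLift L`, `|∇_e F|² = linkGradSq Λ f e`.
[cite: ShenZhuZhu2022, §4 Corollary 4.4 (4.11)] -/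
theorem torus_variance_le_sum_linkGradSq_of_hessBound (L : ℕ) [NeZero L] (β' K₀ : ℝ) (hK : K₀ < 2)
    (hHess : (∀ (V : (GaugeConfig 3 L (Matrix.specialUnitaryGroup (Fin 2) ℂ))) (Λ : (Edge 3 L × Fin (fundamentalLatticeRep 2).N × Fin (fundamentalLatticeRep 2).N × Bool → ℝ) →L[ℝ] ℝ),
      ∑ n : Edge 3 L × NoiseIdx (fundamentalLatticeRep 2).N, ∑ m : Edge 3 L × NoiseIdx (fundamentalLatticeRep 2).N,
        Λ ((fun q : Edge 3 L × Fin (fundamentalLatticeRep 2).N × Fin (fundamentalLatticeRep 2).N × Bool => if n.1 = q.1 then (fun z : ℂ => if q.2.2.2 then z.im else z.re) (((Real.sqrt 2 : ℂ) • ((fundamentalLatticeRep 2).lieProj (noiseDir n.2) * (fun (ee : Edge 3 L) => Matrix.of fun (i j : Fin (fundamentalLatticeRep 2).N) => (((fun (V : GaugeConfig 3 L (Matrix.specialUnitaryGroup (Fin 2) ℂ)) (q : Edge 3 L × Fin (fundamentalLatticeRep 2).N × Fin (fundamentalLatticeRep 2).N × Bool) => (fun z : ℂ => if q.2.2.2 then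 z.im else z.re) ((fundamentalRep (Fin 2) (V q.1) : Matrix (Fin 2) (Fin 2) ℂ) q.2.1 q.2.2.1)) V (ee, i, j, false) : ℝ) : ℂ) + (((fun (V : GaugeConfig 3 L (Matrix.specialUnitaryGroup (Fin 2) ℂ)) (q : Edge 3 L × Fin (fundamentalLatticeRep 2).N × Fin (fundamentalLatticeRep 2).N × Bool) => (fun z : ℂ => if q.2.2.2 then z.im else z.re) ((fundamentalRep (Fin 2) (V q.1) : Matrix (Fin 2) (Fin 2) ℂ) q.2.1 q.2.2.1)) V (ee, i, j, true) : ℝ) : ℂ) * Complex.I) q.1)) q.2.1 q.2.2.1) else 0)) * Λ ((fun q : Edge 3 L × Fin (fundamentalLatticeRep 2).N × Fin (fundamentalLatticeRep 2).N × Bool => if m.1 = q.1 then (fun z : ℂ => if q.2.2.2 then z.im else z.re) (((Real.sqrt 2 : ℂ) • ((fundamentalLatticeRep 2).lieProj (noiseDir m.2) * (fun (ee : Edge 3 L) => Matrix.of fun (i j : Fin (fundamentalLatticeRep 2).N) => (((fun (V : GaugeConfig 3 L (Matrix.specialUnitaryGroup (Fin 2) ℂ)) (q : Edge 3 L × Fin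 (fundamentalLatticeRep 2).N × Fin (fundamentalLatticeRep 2).N × Bool) => (fun z : ℂ => if q.2.2.2 then z.im else z.re) ((fundamentalRep (Fin 2) (V q.1) : Matrix (Fin 2) (Fin 2) ℂ) q.2.1 q.2.2.1)) V (ee, i, j, false) : ℝ) : ℂ) + (((fun (V : GaugeConfig 3 L (Matrix.specialUnitaryGroup (Fin 2) ℂ)) (q : Edge 3 L × Fin (fundamentalLatticeRep 2).N × Fin (fundamentalLatticeRep 2).N × Bool) => (fun z : ℂ => if q.2.2.2 then z.im else z.re) ((fundamentalRep (Fin 2) (V q.1) : Matrix (Fin 2) (Fin 2) ℂ) q.2.1 q.2.2.1)) V (ee, i, j, true) : ℝ) : ℂ) * Complex.I) q.1)) q.2.1 q.2.2.1) else 0)) *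
          fderiv ℝ (fun z : (Edge 3 L × Fin (fundamentalLatticeRep 2).N × Fin (fundamentalLatticeRep 2).N × Bool → ℝ) => fderiv ℝ (fun y : (Edge 3 L × Fin (fundamentalLatticeRep 2).N × Fin (fundamentalLatticeRep 2).N × Bool → ℝ) => β' * ∑ p : Plaquette 3 L, (rootedLoop (fun (ee : Edge 3 L) (i j : Fin (fundamentalLatticeRep 2).N) => ((y (ee, i, j, false) : ℝ) : ℂ) + ((y (ee, i, j, true) : ℝ) : ℂ) * Complex.I) (p.1, p.2.1.1) p.2.1.2 false).trace.re) z (fun q : Edge 3 L × Fin (fundamentalLatticeRep 2).N × Fin (fundamentalLatticeRep 2).N × Bool => if m.1 = q.1 then (fun z : ℂ => if q.2.2.2 then z.im else z.re) (((Real.sqrt 2 : ℂ) • ((fundamentalLatticeRep 2).lieProj (noiseDir m.2) * (fun (ee : Edge 3 L) => Matrix.of fun (i j : Fin (fundamentalLatticeRep 2).N) => ((z (ee, i, j, false) : ℝ) : ℂ) + ((z (ee, i, j, true) : ℝ) : ℂ) * Complex.I) q.1)) q.2.1 q.2.2.1) else 0)) ((fun (V : GaugeConfig 3 L (Matrix.specialUnitaryGroup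 (Fin 2) ℂ)) (q : Edge 3 L × Fin (fundamentalLatticeRep 2).N × Fin (fundamentalLatticeRep 2).N × Bool) => (fun z : ℂ => if q.2.2.2 then z.im else z.re) ((fundamentalRep (Fin 2) (V q.1) : Matrix (Fin 2) (Fin 2) ℂ) q.2.1 q.2.2.1)) V) (fun q : Edge 3 L × Fin (fundamentalLatticeRep 2).N × Fin (fundamentalLatticeRep 2).N × Bool => if n.1 = q.1 then (fun z : ℂ => if q.2.2.2 then z.im else z.re) (((Real.sqrt 2 : ℂ) • ((fundamentalLatticeRep 2).lieProj (noiseDir n.2) * (fun (ee : Edge 3 L) => Matrix.of fun (i j : Fin (fundamentalLatticeRep 2).N) => (((fun (V : GaugeConfig 3 L (Matrix.specialUnitaryGroup (Fin 2) ℂ)) (q : Edge 3 L × Fin (fundamentalLatticeRep 2).N × Fin (fundamentalLatticeRep 2).N × Bool) => (fun z : ℂ => if q.2.2.2 then z.im else z.re) ((fundamentalRep (Fin 2) (V q.1) : Matrix (Fin 2) (Fin 2) ℂ) q.2.1 q.2.2.1)) V (ee, i, j, false) : ℝ) : ℂ) + (((fun (V : GaugeConfig 3 L (Matrix.specialUnitaryGroup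 (Fin 2) ℂ)) (q : Edge 3 L × Fin (fundamentalLatticeRep 2).N × Fin (fundamentalLatticeRep 2).N × Bool) => (fun z : ℂ => if q.2.2.2 then z.im else z.re) ((fundamentalRep (Fin 2) (V q.1) : Matrix (Fin 2) (Fin 2) ℂ) q.2.1 q.2.2.1)) V (ee, i, j, true) : ℝ) : ℂ) * Complex.I) q.1)) q.2.1 q.2.2.1) else 0)
        ≤ K₀ * ∑ n : Edge 3 L × NoiseIdx (fundamentalLatticeRep 2).N, (Λ (fun q : Edge 3 L × Fin (fundamentalLatticeRep 2).N × Fin (fundamentalLatticeRep 2).N × Bool => if n.1 = q.1 then (fun z : ℂ => if q.2.2.2 then z.im else z.re) (((Real.sqrt 2 : ℂ) • ((fundamentalLatticeRep 2).lieProj (noiseDir n.2) * (fun (ee : Edge 3 L) => Matrix.of fun (i j : Fin (fundamentalLatticeRep 2).N) => (((fun (V : GaugeConfig 3 L (Matrix.specialUnitaryGroup (Fin 2) ℂ)) (q : Edge 3 L × Fin (fundamentalLatticeRep 2).N × Fin (fundamentalLatticeRep 2).N × Bool) => (fun z : ℂ => if q.2.2.2 then z.im else z.re) ((fundamentalRep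 (Fin 2) (V q.1) : Matrix (Fin 2) (Fin 2) ℂ) q.2.1 q.2.2.1)) V (ee, i, j, false) : ℝ) : ℂ) + (((fun (V : GaugeConfig 3 L (Matrix.specialUnitaryGroup (Fin 2) ℂ)) (q : Edge 3 L × Fin (fundamentalLatticeRep 2).N × Fin (fundamentalLatticeRep 2).N × Bool) => (fun z : ℂ => if q.2.2.2 then z.im else z.re) ((fundamentalRep (Fin 2) (V q.1) : Matrix (Fin 2) (Fin 2) ℂ) q.2.1 q.2.2.1)) V (ee, i, j, true) : ℝ) : ℂ) * Complex.I) q.1)) q.2.1 q.2.2.1) else 0)) ^ 2))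
    (Λ : Finset (Literature.MathematicalPhysics.QuantumLattice.ZdEdge 3)) (hinj : Set.InjOn (torusEdge (d := 3) L) ↑Λ)
    (f : (↥Λ → Matrix (Fin 2) (Fin 2) ℂ) → ℝ) (hf : ContDiff ℝ ∞ f) :
    ∫ V, (matrixCylinder Λ f (torusLift L V) - ∫ V', matrixCylinder Λ f (torusLift L V') ∂(wilsonMeasure (d := 3) (L := L) (fundamentalRep (Fin 2)) β')) ^ 2 ∂(wilsonMeasure (d := 3) (L := L) (fundamentalRep (Fin 2)) β') ≤
      (∑ e : ↥Λ, ∫ V, linkGradSq Λ f e (fun e' : ↥Λ => ((torusLift L V e'.1 : Matrix.specialUnitaryGroup (Fin 2) ℂ) : Matrix (Fin 2) (Fin 2) ℂ)) ∂(wilsonMeasure (d := 3) (L := L) (fundamentalRep (Fin 2)) β'))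
        / (1 - K₀ / 2) := by
  classical
  set μ' : Measure (GaugeConfig 3 L (Matrix.specialUnitaryGroup (Fin 2) ℂ)) := (wilsonMeasure (d := 3) (L := L) (fundamentalRep (Fin 2)) β') with hμ'
  haveI : IsProbabilityMeasure μ' :=
    isProbabilityMeasure_wilsonMeasure (d := 3) (L := L) (fundamentalRep (Fin 2)) (continuous_fundamentalRep (Fin 2)) β'
  set g : (Edge 3 L × Fin 2 × Fin 2 × Bool → ℝ) → ℝ := fun y => f (fun e : ↥Λ => (fun (ee : Edge 3 L) => Matrix.of fun (i j : Fin (fundamentalLatticeRep 2).N) => ((y (ee, i, j, false) : ℝ) : ℂ) + ((y (ee, i, j, true) : ℝ) : ℂ) * Complex.I) (torusEdge L e.1)) with hg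
  -- `g` is smooth (as in `…ShenZhuZhuFunctionalInequalitiesSU2`)
  set Ψ : (Edge 3 L × Fin 2 × Fin 2 × Bool → ℝ) → (↥Λ → Matrix (Fin 2) (Fin 2) ℂ) := fun y e => (fun (ee : Edge 3 L) => Matrix.of fun (i j : Fin (fundamentalLatticeRep 2).N) => ((y (ee, i, j, false) : ℝ) : ℂ) + ((y (ee, i, j, true) : ℝ) : ℂ) * Complex.I) (torusEdge L e.1) with hΨ
  have hΨadd : ∀ y y', Ψ (y + y') = Ψ y + Ψ y' := by
    intro y y'; funext e; ext i j
    show (((y + y') (torusEdge L e.1, i, j, false) : ℝ) : ℂ) + (((y + y') (torusEdge L e.1, i, j, true) : ℝ) : ℂ) * Complex.I =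
      ((((y (torusEdge L e.1, i, j, false) : ℝ) : ℂ) + ((y (torusEdge L e.1, i, j, true) : ℝ) : ℂ) * Complex.I) +
        (((y' (torusEdge L e.1, i, j, false) : ℝ) : ℂ) + ((y' (torusEdge L e.1, i, j, true) : ℝ) : ℂ) * Complex.I))
    simp only [Pi.add_apply]
    push_cast; ring
  have hΨsmul : ∀ (a : ℝ) y, Ψ (a • y) = a • Ψ y := by
    intro a y; funext e; ext i j
    show (((a • y) (torusEdge L e.1, i, j, false) : ℝ) : ℂ) + (((a • y) (torusEdge L e.1, i, j, true) : ℝ) : ℂ) * Complex.I =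
      a • ((((y (torusEdge L e.1, i, j, false) : ℝ) : ℂ) + ((y (torusEdge L e.1, i, j, true) : ℝ) : ℂ) * Complex.I))
    simp only [Pi.smul_apply, smul_eq_mul, Complex.real_smul]
    push_cast; ring
  let Ψl : (Edge 3 L × Fin 2 × Fin 2 × Bool → ℝ) →ₗ[ℝ] (↥Λ → Matrix (Fin 2) (Fin 2) ℂ) := { toFun := Ψ, map_add' := hΨadd, map_smul' := hΨsmul }
  let Ψc : (Edge 3 L × Fin 2 × Fin 2 × Bool → ℝ) →L[ℝ] (↥Λ → Matrix (Fin 2) (Fin 2) ℂ) := LinearMap.toContinuousLinearMap Ψl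
  have hgΨ : g = f ∘ Ψc := by funext y; rfl
  have hgc' : ContDiff ℝ ∞ g := by rw [hgΨ]; exact hf.comp Ψc.contDiff
  have hgc : ContDiff ℝ 3 g := by exact_mod_cast (contDiff_infty.1 hgc' 3)
  -- `g ∘ coords = F ∘ torusLift`
  have hgco : ∀ y : (GaugeConfig 3 L (Matrix.specialUnitaryGroup (Fin 2) ℂ)), g ((fun (V : GaugeConfig 3 L (Matrix.specialUnitaryGroup (Fin 2) ℂ)) (q : Edge 3 L × Fin (fundamentalLatticeRep 2).N × Fin (fundamentalLatticeRep 2).N × Bool) => (fun z : ℂ => if q.2.2.2 then z.im else z.re) ((fundamentalRep (Fin 2) (V q.1) : Matrix (Fin 2) (Fin 2) ℂ) q.2.1 q.2.2.1)) y) = matrixCylinder Λ f (torusLift L y) := by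
    intro y
    show f _ = f _
    congr 1
    funext e
    exact congrFun (rebuild_coords_of (L := L) y) (torusEdge L e.1)
  -- the energy form of the Poincaré inequality and the dictionary
  have hV : ∫ V, (g ((fun (V : GaugeConfig 3 L (Matrix.specialUnitaryGroup (Fin 2) ℂ)) (q : Edge 3 L × Fin (fundamentalLatticeRep 2).N × Fin (fundamentalLatticeRep 2).N × Bool) => (fun z : ℂ => if q.2.2.2 then z.im else z.re) ((fundamentalRep (Fin 2) (V q.1) : Matrix (Fin 2) (Fin 2) ℂ) q.2.1 q.2.2.1)) V) - ∫ V', g ((fun (V : GaugeConfig 3 L (Matrix.specialUnitaryGroup (Fin 2) ℂ)) (q : Edge 3 L × Fin (fundamentalLatticeRep 2).N × Fin (fundamentalLatticeRep 2).N × Bool) => (fun z : ℂ => if q.2.2.2 then z.im else z.re) ((fundamentalRep (Fin 2) (V q.1) : Matrix (Fin 2) (Fin 2) ℂ) q.2.1 q.2.2.1)) V') ∂μ') ^ 2 ∂μ' ≤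
      (∫ V, (∑ i : Edge 3 L × Fin 2 × Fin 2 × Bool, ∑ j : Edge 3 L × Fin 2 × Fin 2 × Bool, fderiv ℝ g ((fun (V : GaugeConfig 3 L (Matrix.specialUnitaryGroup (Fin 2) ℂ)) (q : Edge 3 L × Fin (fundamentalLatticeRep 2).N × Fin (fundamentalLatticeRep 2).N × Bool) => (fun z : ℂ => if q.2.2.2 then z.im else z.re) ((fundamentalRep (Fin 2) (V q.1) : Matrix (Fin 2) (Fin 2) ℂ) q.2.1 q.2.2.1)) V) (Pi.single i 1) * fderiv ℝ g ((fun (V : GaugeConfig 3 L (Matrix.specialUnitaryGroup (Fin 2) ℂ)) (q : Edge 3 L × Fin (fundamentalLatticeRep 2).N × Fin (fundamentalLatticeRep 2).N × Bool) => (fun z : ℂ => if q.2.2.2 then z.im else z.re) ((fundamentalRep (Fin 2) (V q.1) : Matrix (Fin 2) (Fin 2) ℂ) q.2.1 q.2.2.1)) V) (Pi.single j 1) * (∑ n : Edge 3 L × NoiseIdx 2,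
        (if n.1 = i.1 then (fun z : ℂ => if i.2.2.2 then z.im else z.re)
          ((latticeLangevinDynamics (fundamentalLatticeRep 2) β').noise
            (matrixConfig (fundamentalRep (Fin 2)) V) i.1 n.2 i.2.1 i.2.2.1) else 0) *
        (if n.1 = j.1 then (fun z : ℂ => if j.2.2.2 then z.im else z.re)
          ((latticeLangevinDynamics (fundamentalLatticeRep 2) β').noise
            (matrixConfig (fundamentalRep (Fin 2)) V) j.1 n.2 j.2.1 j.2.2.1) else 0))) ∂μ') / (2 * (1 - K₀ / 2)) :=
    wilson_variance_le_integral_carre_of_hessBound L β' K₀ hK hHess g hgc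
  have hdict : ∀ V : (GaugeConfig 3 L (Matrix.specialUnitaryGroup (Fin 2) ℂ)), (∑ i : Edge 3 L × Fin 2 × Fin 2 × Bool, ∑ j : Edge 3 L × Fin 2 × Fin 2 × Bool, fderiv ℝ g ((fun (V : GaugeConfig 3 L (Matrix.specialUnitaryGroup (Fin 2) ℂ)) (q : Edge 3 L × Fin (fundamentalLatticeRep 2).N × Fin (fundamentalLatticeRep 2).N × Bool) => (fun z : ℂ => if q.2.2.2 then z.im else z.re) ((fundamentalRep (Fin 2) (V q.1) : Matrix (Fin 2) (Fin 2) ℂ) q.2.1 q.2.2.1)) V) (Pi.single i 1) * fderiv ℝ g ((fun (V : GaugeConfig 3 L (Matrix.specialUnitaryGroup (Fin 2) ℂ)) (q : Edge 3 L × Fin (fundamentalLatticeRep 2).N × Fin (fundamentalLatticeRep 2).N × Bool) => (fun z : ℂ => if q.2.2.2 then z.im else z.re) ((fundamentalRep (Fin 2) (V q.1) : Matrix (Fin 2) (Fin 2) ℂ) q.2.1 q.2.2.1)) V) (Pi.single j 1) * (∑ n : Edge 3 L × NoiseIdx 2,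
        (if n.1 = i.1 then (fun z : ℂ => if i.2.2.2 then z.im else z.re)
          ((latticeLangevinDynamics (fundamentalLatticeRep 2) β').noise
            (matrixConfig (fundamentalRep (Fin 2)) V) i.1 n.2 i.2.1 i.2.2.1) else 0) *
        (if n.1 = j.1 then (fun z : ℂ => if j.2.2.2 then z.im else z.re)
          ((latticeLangevinDynamics (fundamentalLatticeRep 2) β').noise
            (matrixConfig (fundamentalRep (Fin 2)) V) j.1 n.2 j.2.1 j.2.2.1) else 0))) =
      2 * ∑ e : ↥Λ, linkGradSq Λ f e (fun e' : ↥Λ => ((torusLift L V e'.1 : Matrix.specialUnitaryGroup (Fin 2) ℂ) : Matrix (Fin 2) (Fin 2) ℂ)) :=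
    fun V => carre_eq_two_mul_sum_linkGradSq L β' Λ hinj f hf V
  simp only [hgco] at hV
  simp_rw [hdict] at hV
  -- `∫ 2Σ_e = 2 Σ_e ∫`
  have hcont : ∀ e : ↥Λ, Continuous fun V : (GaugeConfig 3 L (Matrix.specialUnitaryGroup (Fin 2) ℂ)) =>
      linkGradSq Λ f e (fun e' : ↥Λ => ((torusLift L V e'.1 : Matrix.specialUnitaryGroup (Fin 2) ℂ) : Matrix (Fin 2) (Fin 2) ℂ)) := by
    intro e
    refine (continuous_linkGradSq Λ hf e).comp ?_
    exact continuous_pi fun e' => continuous_subtype_val.comp (continuous_apply _)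
  have hint : ∀ e : ↥Λ, Integrable (fun V : (GaugeConfig 3 L (Matrix.specialUnitaryGroup (Fin 2) ℂ)) =>
      linkGradSq Λ f e (fun e' : ↥Λ => ((torusLift L V e'.1 : Matrix.specialUnitaryGroup (Fin 2) ℂ) : Matrix (Fin 2) (Fin 2) ℂ))) μ' :=
    fun e => integrable_of_continuous_of_compactSpace (hcont e) _
  have hsum : ∫ V, 2 * ∑ e : ↥Λ, linkGradSq Λ f e (fun e' : ↥Λ => ((torusLift L V e'.1 : Matrix.specialUnitaryGroup (Fin 2) ℂ) : Matrix (Fin 2) (Fin 2) ℂ)) ∂μ' =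
      2 * ∑ e : ↥Λ, ∫ V, linkGradSq Λ f e (fun e' : ↥Λ => ((torusLift L V e'.1 : Matrix.specialUnitaryGroup (Fin 2) ℂ) : Matrix (Fin 2) (Fin 2) ℂ)) ∂μ' := by
    rw [integral_const_mul, integral_finsetSum _ fun e _ => hint e]
  rw [hsum] at hV
  have hρ : 0 < 1 - K₀ / 2 := by linarith
  calc ∫ V, (matrixCylinder Λ f (torusLift L V) - ∫ V', matrixCylinder Λ f (torusLift L V') ∂μ') ^ 2 ∂μ'
      ≤ (2 * ∑ e : ↥Λ, ∫ V, linkGradSq Λ f e (fun e' : ↥Λ => ((torusLift L V e'.1 : Matrix.specialUnitaryGroup (Fin 2) ℂ) : Matrix (Fin 2) (Fin 2) ℂ)) ∂μ') / (2 * (1 - K₀ / 2)) := hV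
    _ = (∑ e : ↥Λ, ∫ V, linkGradSq Λ f e (fun e' : ↥Λ => ((torusLift L V e'.1 : Matrix.specialUnitaryGroup (Fin 2) ℂ) : Matrix (Fin 2) (Fin 2) ℂ)) ∂μ') / (1 - K₀ / 2) :=
        mul_div_mul_left _ _ two_ne_zero

/-- ★★ **Entropy on the torus, gradient form** (Shen–Zhu–Zhu Cor. 4.4 (4.11), log-Sobolev half, verbatim for `SU(2)`, `d = 3`): under a
frame-Hessian bound `K₀ < 2`, for every finite `Λ ⊆ E⁺(ℤ³)` projecting injectively to `(ℤ/L)³` and every smooth `f`: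
`∫ G²log G² dμ_(β') − (∫G² dμ_(β')) log ∫G² dμ_(β') ≤ 2(1 − K₀/2)⁻¹ Σ_(e∈Λ) ∫ |∇_e F|² dμ_(β')`, `G = F∘torusLift L`.
[cite: ShenZhuZhu2022, §4 Corollary 4.4 (4.11)] -/
theorem torus_entropy_le_sum_linkGradSq_of_hessBound (L : ℕ) [NeZero L] (β' K₀ : ℝ) (hK : K₀ < 2)
    (hHess : (∀ (V : (GaugeConfig 3 L (Matrix.specialUnitaryGroup (Fin 2) ℂ))) (Λ : (Edge 3 L × Fin (fundamentalLatticeRep 2).N × Fin (fundamentalLatticeRep 2).N × Bool → ℝ) →L[ℝ] ℝ),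
      ∑ n : Edge 3 L × NoiseIdx (fundamentalLatticeRep 2).N, ∑ m : Edge 3 L × NoiseIdx (fundamentalLatticeRep 2).N,
        Λ ((fun q : Edge 3 L × Fin (fundamentalLatticeRep 2).N × Fin (fundamentalLatticeRep 2).N × Bool => if n.1 = q.1 then (fun z : ℂ => if q.2.2.2 then z.im else z.re) (((Real.sqrt 2 : ℂ) • ((fundamentalLatticeRep 2).lieProj (noiseDir n.2) * (fun (ee : Edge 3 L) => Matrix.of fun (i j : Fin (fundamentalLatticeRep 2).N) => (((fun (V : GaugeConfig 3 L (Matrix.specialUnitaryGroup (Fin 2) ℂ)) (q : Edge 3 L × Fin (fundamentalLatticeRep 2).N × Fin (fundamentalLatticeRep 2).N × Bool) => (fun z : ℂ => if q.2.2.2 then z.im else z.re) ((fundamentalRep (Fin 2) (V q.1) : Matrix (Fin 2) (Fin 2) ℂ) q.2.1 q.2.2.1)) V (ee, i, j, false) : ℝ) : ℂ) + (((fun (V : GaugeConfig 3 L (Matrix.specialUnitaryGroup (Fin 2) ℂ)) (q : Edge 3 L × Fin (fundamentalLatticeRep 2).N × Fin (fundamentalLatticeRep 2).N × Bool) => (fun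 z : ℂ => if q.2.2.2 then z.im else z.re) ((fundamentalRep (Fin 2) (V q.1) : Matrix (Fin 2) (Fin 2) ℂ) q.2.1 q.2.2.1)) V (ee, i, j, true) : ℝ) : ℂ) * Complex.I) q.1)) q.2.1 q.2.2.1) else 0)) * Λ ((fun q : Edge 3 L × Fin (fundamentalLatticeRep 2).N × Fin (fundamentalLatticeRep 2).N × Bool => if m.1 = q.1 then (fun z : ℂ => if q.2.2.2 then z.im else z.re) (((Real.sqrt 2 : ℂ) • ((fundamentalLatticeRep 2).lieProj (noiseDir m.2) * (fun (ee : Edge 3 L) => Matrix.of fun (i j : Fin (fundamentalLatticeRep 2).N) => (((fun (V : GaugeConfig 3 L (Matrix.specialUnitaryGroup (Fin 2) ℂ)) (q : Edge 3 L × Fin (fundamentalLatticeRep 2).N × Fin (fundamentalLatticeRep 2).N × Bool) => (fun z : ℂ => if q.2.2.2 then z.im else z.re) ((fundamentalRep (Fin 2) (V q.1) : Matrix (Fin 2) (Fin 2) ℂ) q.2.1 q.2.2.1)) V (ee, i, j, false) : ℝ) : ℂ) + (((fun (V : GaugeConfig 3 L (Matrix.specialUnitaryGroup (Fin 2) ℂ))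 (q : Edge 3 L × Fin (fundamentalLatticeRep 2).N × Fin (fundamentalLatticeRep 2).N × Bool) => (fun z : ℂ => if q.2.2.2 then z.im else z.re) ((fundamentalRep (Fin 2) (V q.1) : Matrix (Fin 2) (Fin 2) ℂ) q.2.1 q.2.2.1)) V (ee, i, j, true) : ℝ) : ℂ) * Complex.I) q.1)) q.2.1 q.2.2.1) else 0)) *
          fderiv ℝ (fun z : (Edge 3 L × Fin (fundamentalLatticeRep 2).N × Fin (fundamentalLatticeRep 2).N × Bool → ℝ) => fderiv ℝ (fun y : (Edge 3 L × Fin (fundamentalLatticeRep 2).N × Fin (fundamentalLatticeRep 2).N × Bool → ℝ) => β' * ∑ p : Plaquette 3 L, (rootedLoop (fun (ee : Edge 3 L) (i j : Fin (fundamentalLatticeRep 2).N) => ((y (ee, i, j, false) : ℝ) : ℂ) + ((y (ee, i, j, true) : ℝ) : ℂ) * Complex.I) (p.1, p.2.1.1) p.2.1.2 false).trace.re) z (fun q : Edge 3 L × Fin (fundamentalLatticeRep 2).N × Fin (fundamentalLatticeRep 2).N × Bool => if m.1 = q.1 then (fun z : ℂ => if q.2.2.2 then z.im else z.re) (((Real.sqrt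 2 : ℂ) • ((fundamentalLatticeRep 2).lieProj (noiseDir m.2) * (fun (ee : Edge 3 L) => Matrix.of fun (i j : Fin (fundamentalLatticeRep 2).N) => ((z (ee, i, j, false) : ℝ) : ℂ) + ((z (ee, i, j, true) : ℝ) : ℂ) * Complex.I) q.1)) q.2.1 q.2.2.1) else 0)) ((fun (V : GaugeConfig 3 L (Matrix.specialUnitaryGroup (Fin 2) ℂ)) (q : Edge 3 L × Fin (fundamentalLatticeRep 2).N × Fin (fundamentalLatticeRep 2).N × Bool) => (fun z : ℂ => if q.2.2.2 then z.im else z.re) ((fundamentalRep (Fin 2) (V q.1) : Matrix (Fin 2) (Fin 2) ℂ) q.2.1 q.2.2.1)) V) (fun q : Edge 3 L × Fin (fundamentalLatticeRep 2).N × Fin (fundamentalLatticeRep 2).N × Bool => if n.1 = q.1 then (fun z : ℂ => if q.2.2.2 then z.im else z.re) (((Real.sqrt 2 : ℂ) • ((fundamentalLatticeRep 2).lieProj (noiseDir n.2) * (fun (ee : Edge 3 L) => Matrix.of fun (i j : Fin (fundamentalLatticeRep 2).N) => (((fun (V : GaugeConfig 3 L (Matrix.specialUnitaryGroup (Fin 2)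 ℂ)) (q : Edge 3 L × Fin (fundamentalLatticeRep 2).N × Fin (fundamentalLatticeRep 2).N × Bool) => (fun z : ℂ => if q.2.2.2 then z.im else z.re) ((fundamentalRep (Fin 2) (V q.1) : Matrix (Fin 2) (Fin 2) ℂ) q.2.1 q.2.2.1)) V (ee, i, j, false) : ℝ) : ℂ) + (((fun (V : GaugeConfig 3 L (Matrix.specialUnitaryGroup (Fin 2) ℂ)) (q : Edge 3 L × Fin (fundamentalLatticeRep 2).N × Fin (fundamentalLatticeRep 2).N × Bool) => (fun z : ℂ => if q.2.2.2 then z.im else z.re) ((fundamentalRep (Fin 2) (V q.1) : Matrix (Fin 2) (Fin 2) ℂ) q.2.1 q.2.2.1)) V (ee, i, j, true) : ℝ) : ℂ) * Complex.I) q.1)) q.2.1 q.2.2.1) else 0)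
        ≤ K₀ * ∑ n : Edge 3 L × NoiseIdx (fundamentalLatticeRep 2).N, (Λ (fun q : Edge 3 L × Fin (fundamentalLatticeRep 2).N × Fin (fundamentalLatticeRep 2).N × Bool => if n.1 = q.1 then (fun z : ℂ => if q.2.2.2 then z.im else z.re) (((Real.sqrt 2 : ℂ) • ((fundamentalLatticeRep 2).lieProj (noiseDir n.2) * (fun (ee : Edge 3 L) => Matrix.of fun (i j : Fin (fundamentalLatticeRep 2).N) => (((fun (V : GaugeConfig 3 L (Matrix.specialUnitaryGroup (Fin 2) ℂ)) (q : Edge 3 L × Fin (fundamentalLatticeRep 2).N × Fin (fundamentalLatticeRep 2).N × Bool) => (fun z : ℂ => if q.2.2.2 then z.im else z.re) ((fundamentalRep (Fin 2) (V q.1) : Matrix (Fin 2) (Fin 2) ℂ) q.2.1 q.2.2.1)) V (ee, i, j, false) : ℝ) : ℂ) + (((fun (V : GaugeConfig 3 L (Matrix.specialUnitaryGroup (Fin 2) ℂ)) (q : Edge 3 L × Fin (fundamentalLatticeRep 2).N × Fin (fundamentalLatticeRep 2).N × Bool) => (fun z : ℂ => if q.2.2.2 then z.im else z.re) ((fundamentalRep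 (Fin 2) (V q.1) : Matrix (Fin 2) (Fin 2) ℂ) q.2.1 q.2.2.1)) V (ee, i, j, true) : ℝ) : ℂ) * Complex.I) q.1)) q.2.1 q.2.2.1) else 0)) ^ 2))
    (Λ : Finset (Literature.MathematicalPhysics.QuantumLattice.ZdEdge 3)) (hinj : Set.InjOn (torusEdge (d := 3) L) ↑Λ)
    (f : (↥Λ → Matrix (Fin 2) (Fin 2) ℂ) → ℝ) (hf : ContDiff ℝ ∞ f) :
    (∫ V, matrixCylinder Λ f (torusLift L V) ^ 2 * Real.log (matrixCylinder Λ f (torusLift L V) ^ 2) ∂(wilsonMeasure (d := 3) (L := L) (fundamentalRep (Fin 2)) β')) -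
        (∫ V, matrixCylinder Λ f (torusLift L V) ^ 2 ∂(wilsonMeasure (d := 3) (L := L) (fundamentalRep (Fin 2)) β')) * Real.log (∫ V, matrixCylinder Λ f (torusLift L V) ^ 2 ∂(wilsonMeasure (d := 3) (L := L) (fundamentalRep (Fin 2)) β')) ≤
      2 * (∑ e : ↥Λ, ∫ V, linkGradSq Λ f e (fun e' : ↥Λ => ((torusLift L V e'.1 : Matrix.specialUnitaryGroup (Fin 2) ℂ) : Matrix (Fin 2) (Fin 2) ℂ)) ∂(wilsonMeasure (d := 3) (L := L) (fundamentalRep (Fin 2)) β'))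
        / (1 - K₀ / 2) := by
  classical
  set μ' : Measure (GaugeConfig 3 L (Matrix.specialUnitaryGroup (Fin 2) ℂ)) := (wilsonMeasure (d := 3) (L := L) (fundamentalRep (Fin 2)) β') with hμ'
  haveI : IsProbabilityMeasure μ' :=
    isProbabilityMeasure_wilsonMeasure (d := 3) (L := L) (fundamentalRep (Fin 2)) (continuous_fundamentalRep (Fin 2)) β'
  set g : (Edge 3 L × Fin 2 × Fin 2 × Bool → ℝ) → ℝ := fun y => f (fun e : ↥Λ => (fun (ee : Edge 3 L) => Matrix.of fun (i j : Fin (fundamentalLatticeRep 2).N) => ((y (ee, i, j, false) : ℝ) : ℂ) + ((y (ee, i, j, true) : ℝ) : ℂ) * Complex.I) (torusEdge L e.1)) with hg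
  set Ψ : (Edge 3 L × Fin 2 × Fin 2 × Bool → ℝ) → (↥Λ → Matrix (Fin 2) (Fin 2) ℂ) := fun y e => (fun (ee : Edge 3 L) => Matrix.of fun (i j : Fin (fundamentalLatticeRep 2).N) => ((y (ee, i, j, false) : ℝ) : ℂ) + ((y (ee, i, j, true) : ℝ) : ℂ) * Complex.I) (torusEdge L e.1) with hΨ
  have hΨadd : ∀ y y', Ψ (y + y') = Ψ y + Ψ y' := by
    intro y y'; funext e; ext i j
    show (((y + y') (torusEdge L e.1, i, j, false) : ℝ) : ℂ) + (((y + y') (torusEdge L e.1, i, j, true) : ℝ) : ℂ) * Complex.I =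
      ((((y (torusEdge L e.1, i, j, false) : ℝ) : ℂ) + ((y (torusEdge L e.1, i, j, true) : ℝ) : ℂ) * Complex.I) +
        (((y' (torusEdge L e.1, i, j, false) : ℝ) : ℂ) + ((y' (torusEdge L e.1, i, j, true) : ℝ) : ℂ) * Complex.I))
    simp only [Pi.add_apply]
    push_cast; ring
  have hΨsmul : ∀ (a : ℝ) y, Ψ (a • y) = a • Ψ y := by
    intro a y; funext e; ext i j
    show (((a • y) (torusEdge L e.1, i, j, false) : ℝ) : ℂ) + (((a • y) (torusEdge L e.1, i, j, true) : ℝ) : ℂ) * Complex.I =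
      a • ((((y (torusEdge L e.1, i, j, false) : ℝ) : ℂ) + ((y (torusEdge L e.1, i, j, true) : ℝ) : ℂ) * Complex.I))
    simp only [Pi.smul_apply, smul_eq_mul, Complex.real_smul]
    push_cast; ring
  let Ψl : (Edge 3 L × Fin 2 × Fin 2 × Bool → ℝ) →ₗ[ℝ] (↥Λ → Matrix (Fin 2) (Fin 2) ℂ) := { toFun := Ψ, map_add' := hΨadd, map_smul' := hΨsmul }
  let Ψc : (Edge 3 L × Fin 2 × Fin 2 × Bool → ℝ) →L[ℝ] (↥Λ → Matrix (Fin 2) (Fin 2) ℂ) := LinearMap.toContinuousLinearMap Ψl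
  have hgΨ : g = f ∘ Ψc := by funext y; rfl
  have hgc' : ContDiff ℝ ∞ g := by rw [hgΨ]; exact hf.comp Ψc.contDiff
  have hgc : ContDiff ℝ 3 g := by exact_mod_cast (contDiff_infty.1 hgc' 3)
  have hgco : ∀ y : (GaugeConfig 3 L (Matrix.specialUnitaryGroup (Fin 2) ℂ)), g ((fun (V : GaugeConfig 3 L (Matrix.specialUnitaryGroup (Fin 2) ℂ)) (q : Edge 3 L × Fin (fundamentalLatticeRep 2).N × Fin (fundamentalLatticeRep 2).N × Bool) => (fun z : ℂ => if q.2.2.2 then z.im else z.re) ((fundamentalRep (Fin 2) (V q.1) : Matrix (Fin 2) (Fin 2) ℂ) q.2.1 q.2.2.1)) y) = matrixCylinder Λ f (torusLift L y) := by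
    intro y
    show f _ = f _
    congr 1
    funext e
    exact congrFun (rebuild_coords_of (L := L) y) (torusEdge L e.1)
  have hE : (∫ V, g ((fun (V : GaugeConfig 3 L (Matrix.specialUnitaryGroup (Fin 2) ℂ)) (q : Edge 3 L × Fin (fundamentalLatticeRep 2).N × Fin (fundamentalLatticeRep 2).N × Bool) => (fun z : ℂ => if q.2.2.2 then z.im else z.re) ((fundamentalRep (Fin 2) (V q.1) : Matrix (Fin 2) (Fin 2) ℂ) q.2.1 q.2.2.1)) V) ^ 2 * Real.log (g ((fun (V : GaugeConfig 3 L (Matrix.specialUnitaryGroup (Fin 2) ℂ)) (q : Edge 3 L × Fin (fundamentalLatticeRep 2).N × Fin (fundamentalLatticeRep 2).N × Bool) => (fun z : ℂ => if q.2.2.2 then z.im else z.re) ((fundamentalRep (Fin 2) (V q.1) : Matrix (Fin 2) (Fin 2) ℂ) q.2.1 q.2.2.1)) V) ^ 2) ∂μ') -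
      (∫ V, g ((fun (V : GaugeConfig 3 L (Matrix.specialUnitaryGroup (Fin 2) ℂ)) (q : Edge 3 L × Fin (fundamentalLatticeRep 2).N × Fin (fundamentalLatticeRep 2).N × Bool) => (fun z : ℂ => if q.2.2.2 then z.im else z.re) ((fundamentalRep (Fin 2) (V q.1) : Matrix (Fin 2) (Fin 2) ℂ) q.2.1 q.2.2.1)) V) ^ 2 ∂μ') * Real.log (∫ V, g ((fun (V : GaugeConfig 3 L (Matrix.specialUnitaryGroup (Fin 2) ℂ)) (q : Edge 3 L × Fin (fundamentalLatticeRep 2).N × Fin (fundamentalLatticeRep 2).N × Bool) => (fun z : ℂ => if q.2.2.2 then z.im else z.re) ((fundamentalRep (Fin 2) (V q.1) : Matrix (Fin 2) (Fin 2) ℂ) q.2.1 q.2.2.1)) V) ^ 2 ∂μ') ≤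
      (∫ V, (∑ i : Edge 3 L × Fin 2 × Fin 2 × Bool, ∑ j : Edge 3 L × Fin 2 × Fin 2 × Bool, fderiv ℝ g ((fun (V : GaugeConfig 3 L (Matrix.specialUnitaryGroup (Fin 2) ℂ)) (q : Edge 3 L × Fin (fundamentalLatticeRep 2).N × Fin (fundamentalLatticeRep 2).N × Bool) => (fun z : ℂ => if q.2.2.2 then z.im else z.re) ((fundamentalRep (Fin 2) (V q.1) : Matrix (Fin 2) (Fin 2) ℂ) q.2.1 q.2.2.1)) V) (Pi.single i 1) * fderiv ℝ g ((fun (V : GaugeConfig 3 L (Matrix.specialUnitaryGroup (Fin 2) ℂ)) (q : Edge 3 L × Fin (fundamentalLatticeRep 2).N × Fin (fundamentalLatticeRep 2).N × Bool) => (fun z : ℂ => if q.2.2.2 then z.im else z.re) ((fundamentalRep (Fin 2) (V q.1) : Matrix (Fin 2) (Fin 2) ℂ) q.2.1 q.2.2.1)) V) (Pi.single j 1) * (∑ n : Edge 3 L × NoiseIdx 2,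
        (if n.1 = i.1 then (fun z : ℂ => if i.2.2.2 then z.im else z.re)
          ((latticeLangevinDynamics (fundamentalLatticeRep 2) β').noise
            (matrixConfig (fundamentalRep (Fin 2)) V) i.1 n.2 i.2.1 i.2.2.1) else 0) *
        (if n.1 = j.1 then (fun z : ℂ => if j.2.2.2 then z.im else z.re)
          ((latticeLangevinDynamics (fundamentalLatticeRep 2) β').noise
            (matrixConfig (fundamentalRep (Fin 2)) V) j.1 n.2 j.2.1 j.2.2.1) else 0))) ∂μ') / (1 - K₀ / 2) :=
    wilson_entropy_le_integral_carre_of_hessBound L β' K₀ hK hHess g hgc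
  have hdict : ∀ V : (GaugeConfig 3 L (Matrix.specialUnitaryGroup (Fin 2) ℂ)), (∑ i : Edge 3 L × Fin 2 × Fin 2 × Bool, ∑ j : Edge 3 L × Fin 2 × Fin 2 × Bool, fderiv ℝ g ((fun (V : GaugeConfig 3 L (Matrix.specialUnitaryGroup (Fin 2) ℂ)) (q : Edge 3 L × Fin (fundamentalLatticeRep 2).N × Fin (fundamentalLatticeRep 2).N × Bool) => (fun z : ℂ => if q.2.2.2 then z.im else z.re) ((fundamentalRep (Fin 2) (V q.1) : Matrix (Fin 2) (Fin 2) ℂ) q.2.1 q.2.2.1)) V) (Pi.single i 1) * fderiv ℝ g ((fun (V : GaugeConfig 3 L (Matrix.specialUnitaryGroup (Fin 2) ℂ)) (q : Edge 3 L × Fin (fundamentalLatticeRep 2).N × Fin (fundamentalLatticeRep 2).N × Bool) => (fun z : ℂ => if q.2.2.2 then z.im else z.re) ((fundamentalRep (Fin 2) (V q.1) : Matrix (Fin 2) (Fin 2) ℂ) q.2.1 q.2.2.1)) V) (Pi.single j 1) * (∑ n : Edge 3 L × NoiseIdx 2,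
        (if n.1 = i.1 then (fun z : ℂ => if i.2.2.2 then z.im else z.re)
          ((latticeLangevinDynamics (fundamentalLatticeRep 2) β').noise
            (matrixConfig (fundamentalRep (Fin 2)) V) i.1 n.2 i.2.1 i.2.2.1) else 0) *
        (if n.1 = j.1 then (fun z : ℂ => if j.2.2.2 then z.im else z.re)
          ((latticeLangevinDynamics (fundamentalLatticeRep 2) β').noise
            (matrixConfig (fundamentalRep (Fin 2)) V) j.1 n.2 j.2.1 j.2.2.1) else 0))) =
      2 * ∑ e : ↥Λ, linkGradSq Λ f e (fun e' : ↥Λ => ((torusLift L V e'.1 : Matrix.specialUnitaryGroup (Fin 2) ℂ) : Matrix (Fin 2) (Fin 2) ℂ)) :=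
    fun V => carre_eq_two_mul_sum_linkGradSq L β' Λ hinj f hf V
  simp only [hgco] at hE
  simp_rw [hdict] at hE
  have hcont : ∀ e : ↥Λ, Continuous fun V : (GaugeConfig 3 L (Matrix.specialUnitaryGroup (Fin 2) ℂ)) =>
      linkGradSq Λ f e (fun e' : ↥Λ => ((torusLift L V e'.1 : Matrix.specialUnitaryGroup (Fin 2) ℂ) : Matrix (Fin 2) (Fin 2) ℂ)) := by
    intro e
    refine (continuous_linkGradSq Λ hf e).comp ?_
    exact continuous_pi fun e' => continuous_subtype_val.comp (continuous_apply _)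
  have hint : ∀ e : ↥Λ, Integrable (fun V : (GaugeConfig 3 L (Matrix.specialUnitaryGroup (Fin 2) ℂ)) =>
      linkGradSq Λ f e (fun e' : ↥Λ => ((torusLift L V e'.1 : Matrix.specialUnitaryGroup (Fin 2) ℂ) : Matrix (Fin 2) (Fin 2) ℂ))) μ' :=
    fun e => integrable_of_continuous_of_compactSpace (hcont e) _
  have hsum : ∫ V, 2 * ∑ e : ↥Λ, linkGradSq Λ f e (fun e' : ↥Λ => ((torusLift L V e'.1 : Matrix.specialUnitaryGroup (Fin 2) ℂ) : Matrix (Fin 2) (Fin 2) ℂ)) ∂μ' =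
      2 * ∑ e : ↥Λ, ∫ V, linkGradSq Λ f e (fun e' : ↥Λ => ((torusLift L V e'.1 : Matrix.specialUnitaryGroup (Fin 2) ℂ) : Matrix (Fin 2) (Fin 2) ℂ)) ∂μ' := by
    rw [integral_const_mul, integral_finsetSum _ fun e _ => hint e]
  rw [hsum, mul_div_assoc] at hE
  rw [mul_div_assoc]
  exact hE

end Torus

end Summit.QuantumFields.YangMills.Theorems.ColdStartUniversality
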